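import Summits.QuantumFields.YangMills.Theorems.DiagonalMirrorRPRWilsonDiagonalModelModel
import Summits.QuantumFields.YangMills.Theorems.DiagonalMirrorRPRTepidLetters

/-!
# Crux `WeakCouplingHypercubicLimitRP` (stmt-QuantumFields-27398) / aside `DiagonalMirrorRPR` (stmt-QuantumFields-10604), door B,
# construction F1_diag — step A′(i): the five FAMILY FACTS of an eigen-package (pairing identity and domination as statements about the data)

Helper file (`--supports stmt-QuantumFields-27398 --as helper`) of the hand `hand-10604-wilsonDiagModel-2` g2 (self-review of p829712).  WHY THIS FILE:
`wilsonDiagonalModel` (✓p829712, `…Model`) takes its slice at each `k` by `Classical.choice (nonempty_sliceFields …)` — a choice over the TYPE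
`SliceFields r sch k`, whose inhabitants are constrained only by the interface's own clauses; it therefore PROVES `Nonempty (DiagonalSliceModel r sch)`
by the Wilson construction but its data fields are not provably the Wilson spectral data (the slice type, like the interface, also has junk
inhabitants).  Letters typed on it would be about an unspecified inhabitant.  Here the choice is moved to where every inhabitant IS Wilson data:
* `slicePkgAt r sch hβ k : SlicePkg …` — a chosen EIGEN-PACKAGE (`Classical.choice nonempty_slicePkg`): THE `L²(μ̃)` operator of the reweighted lifted
  kernel `𝔟` (unique given the bond bound), AN orthonormal eigenbasis, ITS eigenvalues, an injection of the index set into `ℕ` — every inhabitant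
  of `SlicePkg` is genuine, and the letters are invariant under the residual freedom (basis, padding, bond bound: unitarily equivalent operators);
* `SlicePkg.toFields` — ALL slice fields by EXPLICIT FORMULAS from a package: `sp = posPad emb κ`, `sm = negPad emb κ`, `top` = the (unique) top
  modulus, `wp F = P.wp (famRead F k (d_k)), wm F = P.wm (…)` (Gram weights `κᵢ²⟪bᵢ, 𝒲_F bᵢ⟫`); proofs = those of `nonempty_sliceFields`;
* `pinnedSliceFields`, ★★★ **`wilsonDiagonalTransferModel r sch hβ : DiagonalSliceModel r sch`** — the model OF RECORD for the door-B letters; and the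
  unfolding lemmas `wilsonDiagonalTransferModel_sp/_sm/_wp/_wm` (at `side_k ≥ 3`), `_depth`, so that e.g. R1 `OddTwistGap (wilsonDiagonalTransferModel …)`
  is, index by index, the statement «every NEGATIVE eigenvalue `κᵢ` of `𝔄_k` has `|κᵢ| ≤ e^{-γ a_k} · top_k`».

HONEST FRAMING: construction; no letter proved; D1′, ⟨27398⟩, S6i, ⟨10604⟩ OPEN; the Yang–Mills mass gap is NOT proved here or anywhere in the tree.
No instance, no notation, `autoImplicit false`.

References: K. Osterwalder, E. Seiler, Ann. Phys. 110 (1978) §2–3; M. Reed, B. Simon I (1980) §VI.6; B. Simon, *Trace Ideals* (2005) Ch. 3.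
-/

set_option autoImplicit false

noncomputable section

open scoped BigOperators ENNReal RealInnerProductSpace
open MeasureTheory Function Filter Topology
open Literature.MathematicalPhysics.QuantumLattice Literature.MathematicalPhysics.QuantumFieldTheory
open Summit.QuantumFields.YangMills.Cruxes.DiagonalMirrorRPR.ParityBridgeColdTraces

namespace Summit.QuantumFields.YangMills.Cruxes.DiagonalMirrorRPR.SignTwistedDiagonalTrace.WilsonDiagonal

section FamilyFacts

variable {G : Type} [Group G] [TopologicalSpace G] [IsTopologicalGroup G] [CompactSpace G] [MeasurableSpace G] [BorelSpace G]
  (r : LatticeRep G) (sch : SpeciesScheme (YMSpecies G))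

/-- **The five family facts of an eigen-package** at an index with `side_k ≥ 3`: for every reflected family, the padded Gram weights are non-negative and
bounded, and — in the regime `2 d_k + 6 ≤ side_k` with slab support — satisfy the PAIRING IDENTITY (chain length `S_k`) and the WEIGHT DOMINATION (chain
length `2t + 2d_k + 4`) against the padded signed eigenvalues `posPad emb κ / negPad emb κ` (the proof of `nonempty_sliceFields`, stated for the data). -/
theorem SlicePkg.family_facts {k : ℕ} (hβ : 0 ≤ sch.β k) (h3 : 3 ≤ sch.side k)
    (P : SlicePkg (sch.side k) G r.N r.ρ (sch.β k)) (F : ReflectedFamily) :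
    (∀ j, 0 ≤ P.wp (famRead r sch F k (famDepthSeq r sch F k)) j) ∧ (∀ j, 0 ≤ P.wm (famRead r sch F k (famDepthSeq r sch F k)) j) ∧
    (∃ W : ℝ, ∀ j, P.wp (famRead r sch F k (famDepthSeq r sch F k)) j ≤ W ∧ P.wm (famRead r sch F k (famDepthSeq r sch F k)) j ≤ W) ∧
    (2 * famDepthSeq r sch F k + 6 ≤ sch.side k →
      (∀ Z Z' : ZMod (sch.side k) → LayerCfg (sch.side k) (sch.side k) G,
        (∀ t : ℤ, 1 ≤ t → t ≤ famDepthSeq r sch F k → Z (t : ZMod (sch.side k)) = Z' (t : ZMod (sch.side k))) →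
        famObs r sch F k (torusLift (sch.side k) (layerAssembleU Z)) = famObs r sch F k (torusLift (sch.side k) (layerAssembleU Z'))) →
      gramPairing r sch F k * (∑' j, posPad P.emb P.κ j ^ sch.side k - ∑' j, negPad P.emb P.κ j ^ sch.side k) =
        ∑' j, posPad P.emb P.κ j ^ (sch.side k - 2 * (famDepthSeq r sch F k + 2)) * P.wp (famRead r sch F k (famDepthSeq r sch F k)) j -
          ∑' j, negPad P.emb P.κ j ^ (sch.side k - 2 * (famDepthSeq r sch F k + 2)) * P.wm (famRead r sch F k (famDepthSeq r sch F k)) j) ∧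
    (2 * famDepthSeq r sch F k + 6 ≤ sch.side k →
      (∀ Z Z' : ZMod (sch.side k) → LayerCfg (sch.side k) (sch.side k) G,
        (∀ t : ℤ, 1 ≤ t → t ≤ famDepthSeq r sch F k → Z (t : ZMod (sch.side k)) = Z' (t : ZMod (sch.side k))) →
        famObs r sch F k (torusLift (sch.side k) (layerAssembleU Z)) = famObs r sch F k (torusLift (sch.side k) (layerAssembleU Z'))) →
      ∀ (t : ℕ) (B : ℝ), (∀ V, |famObs r sch F k V| ≤ B) →
      ∑' j, posPad P.emb P.κ j ^ (2 * t) * P.wp (famRead r sch F k (famDepthSeq r sch F k)) j + ∑' j, negPad P.emb P.κ j ^ (2 * t) * P.wm (famRead r sch F k (famDepthSeq r sch F k)) j ≤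
        B ^ 2 * (∑' j, posPad P.emb P.κ j ^ (2 * t + 2 * (famDepthSeq r sch F k + 2)) +
          ∑' j, negPad P.emb P.κ j ^ (2 * t + 2 * (famDepthSeq r sch F k + 2)))) := by
  haveI : SecondCountableTopology G := (r.continuous.isClosedEmbedding r.injective).isEmbedding.secondCountableTopology
  have hS : Odd (sch.side k) := ⟨sch.L k, rfl⟩
  haveI := P.countable
  haveI := isFiniteMeasure_tMeasure (S := sch.side k) (G := G) (Nc := r.N) hβ P.M
  have he := P.emb_injective
  obtain ⟨top, htop, hsp0, hsm0, hsple, hsmle, hatt, hsum_sp, hsum_sm, hdisj, htrace, hodd, hside⟩ :=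
    spectralData_of_hasSum (S := sch.side k) (G := G) r.ρ hS h3 r.continuous (sch.β k) he P.summable_sq P.trace
  have hκA : ∀ i, |P.κ i| ≤ ‖P.A‖ := Literature.Analysis.OperatorTheory.abs_lam_le_norm P.hb
  -- per-family data: observable of depth `d_k + 1`, its bound, its block operator, the Gram weights
  have hfam : ∀ F : ReflectedFamily, ∃ (B : ℝ) (W : Lp ℝ 2 (tMeasure (sch.side k) G r.N (sch.β k) P.M) →L[ℝ]
      Lp ℝ 2 (tMeasure (sch.side k) G r.N (sch.β k) P.M)),
      (∀ V, |famObs r sch F k V| ≤ B) ∧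
      (∀ φ, (W φ : ℕ × HalfCfg (sch.side k) (sch.side k) G → ℝ) =ᵐ[tMeasure (sch.side k) G r.N (sch.β k) P.M]
        fun x => ∫ y, blockKernel (sch.side k) G r.N r.ρ (sch.β k) P.M (famRead r sch F k (famDepthSeq r sch F k)) x y * φ y
          ∂(tMeasure (sch.side k) G r.N (sch.β k) P.M)) ∧
      (∀ i, P.gram (famRead r sch F k (famDepthSeq r sch F k)) i = ⟪P.b i, W (P.b i)⟫) ∧
      (∀ i, 0 ≤ P.weight (famRead r sch F k (famDepthSeq r sch F k)) i) ∧
      (∀ i, P.weight (famRead r sch F k (famDepthSeq r sch F k)) i ≤ (∑' j, P.κ j ^ 2) * ‖W‖) ∧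
      (∀ n, Summable fun i => P.κ i ^ n * P.weight (famRead r sch F k (famDepthSeq r sch F k)) i) := by
    intro F
    obtain ⟨B, hB⟩ := exists_abs_famObs_le r sch F k
    have hf := measurable_famRead r sch F k (famDepthSeq r sch F k)
    have hfB := abs_famRead_le r sch F k (famDepthSeq r sch F k) hB
    obtain ⟨W, hW⟩ := exists_blockKernelOp (S := sch.side k) (Nc := r.N) r.ρ r.continuous hβ P.hM hf hfB
    have hgram : ∀ i, P.gram (famRead r sch F k (famDepthSeq r sch F k)) i = ⟪P.b i, W (P.b i)⟫ := fun i => by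
      rw [Literature.Analysis.OperatorTheory.inner_kernelOp_eq_integral hW]; rfl
    have hw0 : ∀ i, 0 ≤ P.weight (famRead r sch F k (famDepthSeq r sch F k)) i := fun i => by
      unfold SlicePkg.weight
      rw [hgram]
      exact mul_nonneg (sq_nonneg _) (inner_blockKernelOp_self_nonneg r.ρ r.continuous hβ P.hM hf hfB hW _)
    have hwle : ∀ i, P.weight (famRead r sch F k (famDepthSeq r sch F k)) i ≤ (∑' j, P.κ j ^ 2) * ‖W‖ := fun i => by
      unfold SlicePkg.weight
      rw [hgram]
      exact mul_le_mul (P.summable_sq.le_tsum i fun j _ => sq_nonneg _) ((le_abs_self _).trans (abs_inner_basis_le_opNorm P.b W i))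
        ((hgram i) ▸ (hgram i ▸ inner_blockKernelOp_self_nonneg r.ρ r.continuous hβ P.hM hf hfB hW _)) (tsum_nonneg fun j => sq_nonneg _)
    have hsumw : ∀ n, Summable fun i => P.κ i ^ n * P.weight (famRead r sch F k (famDepthSeq r sch F k)) i := fun n => by
      refine Summable.of_norm_bounded (g := fun i => ‖P.A‖ ^ n * (‖W‖ * P.κ i ^ 2)) ((P.summable_sq.mul_left _).mul_left _) fun i => ?_
      rw [Real.norm_eq_abs, abs_mul, abs_pow]
      refine mul_le_mul (pow_le_pow_left₀ (abs_nonneg _) (hκA i) n) ?_ (abs_nonneg _) (by positivity)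
      unfold SlicePkg.weight
      rw [abs_mul, abs_of_nonneg (sq_nonneg _), hgram, mul_comm]
      exact mul_le_mul_of_nonneg_right (abs_inner_basis_le_opNorm P.b W i) (sq_nonneg _)
    exact ⟨B, W, hB, hW, hgram, hw0, hwle, hsumw⟩
  choose Bf Wf hBf hWf hgramf hw0f hwlef hsumwf using hfam
  -- notation
  set sp : ℕ → ℝ := posPad P.emb P.κ with hspdef
  set sm : ℕ → ℝ := negPad P.emb P.κ with hsmdef
  set w : ReflectedFamily → P.s → ℝ := fun F i => P.weight (famRead r sch F k (famDepthSeq r sch F k)) i with hwdef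
  -- the padded weighted sums
  have hpos_sum : ∀ (F : ReflectedFamily) (n : ℕ), ∑' j, sp j ^ n * P.wp (famRead r sch F k (famDepthSeq r sch F k)) j =
      ∑' i, (if 0 < P.κ i then P.κ i ^ n * w F i else 0) := by
    intro F n
    have hfun : (fun j => sp j ^ n * P.wp (famRead r sch F k (famDepthSeq r sch F k)) j) =
        Function.extend P.emb (fun i => if 0 < P.κ i then P.κ i ^ n * w F i else 0) 0 := by
      rw [hspdef, posPad, SlicePkg.wp, pow_extend_mul_extend he]
      congr 1
      funext i
      split_ifs with h
      · rw [max_eq_left h.le]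
      · rw [mul_zero]
    rw [hfun, tsum_extend_eq he]
    refine Summable.of_norm_bounded (g := fun i => ‖P.κ i ^ n * w F i‖) (hsumwf F n).norm fun i => ?_
    split_ifs
    · exact le_rfl
    · rw [norm_zero]; exact norm_nonneg _
  have hneg_sum : ∀ (F : ReflectedFamily) (n : ℕ), ∑' j, sm j ^ n * P.wm (famRead r sch F k (famDepthSeq r sch F k)) j =
      ∑' i, (if P.κ i < 0 then (-P.κ i) ^ n * w F i else 0) := by
    intro F n
    have hfun : (fun j => sm j ^ n * P.wm (famRead r sch F k (famDepthSeq r sch F k)) j) =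
        Function.extend P.emb (fun i => if P.κ i < 0 then (-P.κ i) ^ n * w F i else 0) 0 := by
      rw [hsmdef, negPad, SlicePkg.wm, pow_extend_mul_extend he]
      congr 1
      funext i
      split_ifs with h
      · rw [max_eq_left (neg_nonneg.2 h.le)]
      · rw [mul_zero]
    rw [hfun, tsum_extend_eq he]
    refine Summable.of_norm_bounded (g := fun i => ‖P.κ i ^ n * w F i‖) (hsumwf F n).norm fun i => ?_
    split_ifs
    · rw [norm_mul, norm_mul, norm_pow, norm_pow, norm_neg]
    · rw [norm_zero]; exact norm_nonneg _
  -- ★ the spectral sums of the weights: odd exponents (pairing) and even exponents (domination)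
  have hodd_sum : ∀ (F : ReflectedFamily) (n : ℕ), Odd n →
      ∑' j, sp j ^ n * P.wp (famRead r sch F k (famDepthSeq r sch F k)) j -
        ∑' j, sm j ^ n * P.wm (famRead r sch F k (famDepthSeq r sch F k)) j = ∑' i, P.κ i ^ n * w F i := by
    intro F n hn
    rw [hpos_sum, hneg_sum]
    have hs1 : Summable fun i => if 0 < P.κ i then P.κ i ^ n * w F i else 0 :=
      Summable.of_norm_bounded (g := fun i => ‖P.κ i ^ n * w F i‖) (hsumwf F n).norm fun i => by
        split_ifs
        · exact le_rfl
        · rw [norm_zero]; exact norm_nonneg _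
    have hs2 : Summable fun i => if P.κ i < 0 then (-P.κ i) ^ n * w F i else 0 :=
      Summable.of_norm_bounded (g := fun i => ‖P.κ i ^ n * w F i‖) (hsumwf F n).norm fun i => by
        split_ifs
        · rw [norm_mul, norm_mul, norm_pow, norm_pow, norm_neg]
        · rw [norm_zero]; exact norm_nonneg _
    rw [← hs1.tsum_sub hs2]
    refine tsum_congr fun i => ?_
    rcases lt_trichotomy (P.κ i) 0 with h | h | h
    · rw [if_neg (not_lt.2 h.le), if_pos h, hn.neg_pow]; ring
    · rw [if_neg (by rw [h]; exact lt_irrefl _), if_neg (by rw [h]; exact lt_irrefl _), h,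
        zero_pow (by rintro rfl; exact (Nat.not_odd_zero hn).elim)]; ring
    · rw [if_pos h, if_neg (not_lt.2 h.le)]; ring
  have heven_sum : ∀ (F : ReflectedFamily) (t : ℕ),
      ∑' j, sp j ^ (2 * t) * P.wp (famRead r sch F k (famDepthSeq r sch F k)) j +
        ∑' j, sm j ^ (2 * t) * P.wm (famRead r sch F k (famDepthSeq r sch F k)) j = ∑' i, P.κ i ^ (2 * t) * w F i := by
    intro F t
    rw [hpos_sum, hneg_sum]
    have hs1 : Summable fun i => if 0 < P.κ i then P.κ i ^ (2 * t) * w F i else 0 :=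
      Summable.of_norm_bounded (g := fun i => ‖P.κ i ^ (2 * t) * w F i‖) (hsumwf F (2 * t)).norm fun i => by
        split_ifs
        · exact le_rfl
        · rw [norm_zero]; exact norm_nonneg _
    have hs2 : Summable fun i => if P.κ i < 0 then (-P.κ i) ^ (2 * t) * w F i else 0 :=
      Summable.of_norm_bounded (g := fun i => ‖P.κ i ^ (2 * t) * w F i‖) (hsumwf F (2 * t)).norm fun i => by
        split_ifs
        · rw [norm_mul, norm_mul, norm_pow, norm_pow, norm_neg]
        · rw [norm_zero]; exact norm_nonneg _
    rw [← hs1.tsum_add hs2]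
    refine tsum_congr fun i => ?_
    rcases lt_trichotomy (P.κ i) 0 with h | h | h
    · rw [if_neg (not_lt.2 h.le), if_pos h, (even_two_mul t).neg_pow]; ring
    · have hw00 : w F i = 0 := by
        simp only [hwdef, SlicePkg.weight, h]; ring
      rw [if_neg (by rw [h]; exact lt_irrefl _), if_neg (by rw [h]; exact lt_irrefl _), hw00]; ring
    · rw [if_pos h, if_neg (not_lt.2 h.le)]; ring
  -- ★ the spectral sums as chain integrals: `Σ κ^n w = Σ κ^{n+2} ⟪b, 𝒲 b⟫ = ∫ Θf f ∏` on the chain of length `n + 2 d_k + 4`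
  have hchain : ∀ (F : ReflectedFamily) (n : ℕ) {m : ℕ} [NeZero m], m = n + 2 * famDepthSeq r sch F k + 4 →
      ∑' i, P.κ i ^ n * w F i =
        ∫ Q : ZMod m → HalfCfg (sch.side k) (sch.side k) G × HalfCfg (sch.side k) (sch.side k) G,
          obsL (famRead r sch F k (famDepthSeq r sch F k)) Q * obsR (famRead r sch F k (famDepthSeq r sch F k)) Q *
            ∏ t : ZMod m, Real.exp (sch.β k * evenActionU r.ρ (Q t).1 (Q t).2 (Q (t + 1)).1) *
              Real.exp (sch.β k * oddActionU r.ρ (Q t).2 (Q (t + 1)).1 (Q (t + 1)).2)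
          ∂(Measure.pi fun _ => (halfHaar (sch.side k) G).prod (halfHaar (sch.side k) G)) := by
    intro F n m _ hm
    have h := hasSum_pow_mul_inner_blockKernelOp (S := sch.side k) (Nc := r.N) r.ρ r.continuous hβ r.mem_unitary P.hM P.hA P.hb
      (measurable_famRead r sch F k (famDepthSeq r sch F k)) (abs_famRead_le r sch F k (famDepthSeq r sch F k) (hBf F)) (hWf F) n hm
    rw [← h.tsum_eq]
    refine tsum_congr fun i => ?_
    simp only [hwdef, SlicePkg.weight, hgramf]
    ring
  -- assemble the five facts for `F`
  refine ⟨fun j => extend_nonneg _ (fun i => by split_ifs; exacts [hw0f F i, le_rfl]) he j,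
    fun j => extend_nonneg _ (fun i => by split_ifs; exacts [hw0f F i, le_rfl]) he j, ?_, fun h26 hdep => ?_,
    fun h26 hdep t B hB => ?_⟩
  · -- bounded weights
    have hW0 : 0 ≤ (∑' j, P.κ j ^ 2) * ‖Wf F‖ := mul_nonneg (tsum_nonneg fun j => sq_nonneg _) (norm_nonneg _)
    refine ⟨(∑' j, P.κ j ^ 2) * ‖Wf F‖, fun j => ⟨?_, ?_⟩⟩
    · exact extend_le_of_le _ hW0 (fun i => by split_ifs; exacts [hwlef F i, hW0]) he j
    · exact extend_le_of_le _ hW0 (fun i => by split_ifs; exacts [hwlef F i, hW0]) he j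
  · -- ★ the pairing identity at chain length `S_k`
    set e := famDepthSeq r sch F k with hedef
    have hn : Odd (sch.side k - 2 * (e + 2)) := by
      obtain ⟨L, hL⟩ := hS
      exact ⟨L - e - 2, by omega⟩
    rw [hodd_sum F _ hn]
    haveI : NeZero (sch.side k) := ⟨by omega⟩
    rw [hchain F (sch.side k - 2 * (e + 2)) (m := sch.side k) (by omega)]
    -- the left-hand side: `gramPairing · Tr K_u^S` through hand-2's insertion form
    obtain ⟨-, -, htrS⟩ := htrace (sch.side k) (by omega)
    rw [hS.neg_one_pow, neg_one_mul, ← sub_eq_add_neg] at htrS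
    rw [htrS, gramPairing_mul_diagCyclicTraceU_eq_integral_pairs r sch F k]
    refine integral_congr_ae (ae_of_all _ fun Q => ?_)
    dsimp only
    have hR : ∀ Q' : ZMod (sch.side k) → HalfCfg (sch.side k) (sch.side k) G × HalfCfg (sch.side k) (sch.side k) G,
        obsR (famRead r sch F k e) Q' = famObs r sch F k (torusLift (sch.side k) (layerAssembleU fun t => glue (Q' t).1 (Q' t).2)) :=
      fun Q' => obsR_famRead r sch F k e e (Nat.le_succ e) (by omega) hdep Q'
    rw [← obsR_reflectPairs, hR, hR]
  · -- ★ the weight domination at chain length `2t + 2 d_k + 4`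
    set e := famDepthSeq r sch F k with hedef
    rw [heven_sum F t]
    haveI : NeZero (2 * t + 2 * e + 4) := ⟨by omega⟩
    rw [hchain F (2 * t) (m := 2 * t + 2 * e + 4) rfl]
    obtain ⟨-, -, htr2⟩ := htrace (2 * t + 2 * e + 4) (by omega)
    rw [(show Even (2 * t + 2 * e + 4) from ⟨t + e + 2, by omega⟩).neg_one_pow, one_mul] at htr2
    rw [show 2 * t + 2 * (e + 2) = 2 * t + 2 * e + 4 by ring, htr2]
    exact integral_obsLR_mul_pairChain_le (S := sch.side k) r.ρ r.continuous (sch.β k)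
      (measurable_famRead r sch F k e) (abs_famRead_le r sch F k e hB)


/-- The nine spectral fields of an eigen-package (hand-1's `spectralData_of_hasSum`, specialised). -/
theorem SlicePkg.spectral {k : ℕ} (h3 : 3 ≤ sch.side k) (P : SlicePkg (sch.side k) G r.N r.ρ (sch.β k)) :
    ∃ top : ℝ,
      0 < top ∧ (∀ j, 0 ≤ posPad P.emb P.κ j) ∧ (∀ j, 0 ≤ negPad P.emb P.κ j) ∧ (∀ j, posPad P.emb P.κ j ≤ top) ∧
      (∀ j, negPad P.emb P.κ j ≤ top) ∧ (∃ j, posPad P.emb P.κ j = top ∨ negPad P.emb P.κ j = top) ∧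
      Summable (fun j => posPad P.emb P.κ j ^ 2) ∧ Summable (fun j => negPad P.emb P.κ j ^ 2) ∧
      (∀ j, posPad P.emb P.κ j = 0 ∨ negPad P.emb P.κ j = 0) ∧
      (∀ (m : ℕ) [NeZero m], 2 ≤ m →
        Summable (fun j => posPad P.emb P.κ j ^ m) ∧ Summable (fun j => negPad P.emb P.κ j ^ m) ∧
          ∑' j, posPad P.emb P.κ j ^ m + (-1) ^ m * ∑' j, negPad P.emb P.κ j ^ m =
            diagCyclicTraceU r.ρ (sch.β k) m (S := sch.side k) (G := G)) ∧
      (∀ m, 3 ≤ m → Odd m → ∑' j, negPad P.emb P.κ j ^ m ≤ ∑' j, posPad P.emb P.κ j ^ m) ∧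
      ∑' j, negPad P.emb P.κ j ^ sch.side k < ∑' j, posPad P.emb P.κ j ^ sch.side k := by
  haveI : SecondCountableTopology G := (r.continuous.isClosedEmbedding r.injective).isEmbedding.secondCountableTopology
  haveI := P.countable
  exact spectralData_of_hasSum (S := sch.side k) (G := G) r.ρ ⟨sch.L k, rfl⟩ h3 r.continuous (sch.β k) P.emb_injective P.summable_sq P.trace

end FamilyFacts

end Summit.QuantumFields.YangMills.Cruxes.DiagonalMirrorRPR.SignTwistedDiagonalTrace.WilsonDiagonal

end
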